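import Mathlib
import HarnessLib
import Literature.Analysis.FluidPDE.VectorCalculus
import Literature.Analysis.FluidPDE.VorticityCalculus
import Literature.Analysis.FluidPDE.BiotSavartCurlPair
import Literature.Analysis.FluidPDE.BiotSavartNewtonKernel
import Summits.NavierStokesRegularity.NavierStokesRegularity.Theorems.UnthreadedDoorAntidynamoToroidalFieldHarmonic

/-!
# Route `UnthreadedDoor` / `ThreadingFlux`, crux `PoloidalLiouville` (stmt-NavierStokesRegularity-1222), antidynamo v2 skeleton
# (sha16 `4ebf5683127b`), rung `stub_singleDegreeRung`, EVEN degree — input (E2): THE LAMB VECTOR OF A SINGLE-DEGREE FIELD AND ITS CURL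

Support file (seat leafhand-ns-unthreadeddoor-1 g1, cell decomp-ns), `--supports stmt-NavierStokesRegularity-1222 --as helper`; theorems only.

For the even-degree rung the vorticity equation has to be evaluated on the decomposed slice `V = (a(r) P) • y + k(r) • ∇P`
(`y = x − x₀`, `r = ‖y‖`) against the vorticity `ω = G(r) • Λ`, `Λ = ∇P × y`.  This file records the pointwise algebra and the two
curl rules that turn `curl (V × ω)` into gradients:

* `cross_singleDegree_lamb` — BAC–CAB: `((aP) • y + k • g) × (G • (g × y)) = (G (aP ⟪y,y⟫ + k ⟪g,y⟫)) • g − (G (aP ⟪g,y⟫ + k ⟪g,g⟫)) • y`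
  (pure vector algebra; with Euler `⟪∇P, y⟫ = l P` this is `G(a r² + k l) P ∇P − G(a l P² + k |∇P|²) y`);
* `curl_smul_id_eq_cross_gradient` — `curl (h • id)(x) = ∇h(x) × x`;
* `curl_smul_gradient_eq_cross` — `curl (β • ∇Q)(x) = ∇β(x) × ∇Q(x)` for `Q ∈ C²`;
* `curl_lamb_eq` — hence `curl (V × ω) = ∇β × ∇P − ∇h × id` with `β = G (aP⟪y,y⟫ + k⟪∇P,y⟫)`, `h = G (aP⟪∇P,y⟫ + k⟪∇P,∇P⟫)`,
  at every point where the scalar fields `y ↦ a ‖y‖, k ‖y‖, G ‖y‖` are differentiable (e.g. off the centre for `C¹` profiles).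

HONEST LABEL: algebra/calculus input for the open even-degree rung; nothing here proves the rung, the wall, `PoloidalLiouville` (1222),
or bears on Navier–Stokes regularity. [folklore]
-/

noncomputable section

-- the summit and its single sub-problem share the name (CONVENTIONS §1)
set_option linter.dupNamespace false

open scoped Topology InnerProductSpace RealInnerProductSpace ContDiff
open Filter Set Function Metric
open Literature.Analysis.FluidPDE

namespace Summit.NavierStokesRegularity.NavierStokesRegularity.Theorems.PoloidalLiouville.Antidynamo

/-- **BAC–CAB for the single-degree Lamb vector**:
`((a P) • y + k • g) × (G • (g × y)) = (G (a P ⟪y,y⟫ + k ⟪g,y⟫)) • g − (G (a P ⟪g,y⟫ + k ⟪g,g⟫)) • y`. [folklore] -/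
theorem cross_singleDegree_lamb (a k G P : ℝ) (g y : EuclideanSpace ℝ (Fin 3)) :
    cross ((a * P) • y + k • g) (G • cross g y) =
      (G * (a * P * ⟪y, y⟫ + k * ⟪g, y⟫)) • g - (G * (a * P * ⟪g, y⟫ + k * ⟪g, g⟫)) • y := by
  ext i
  fin_cases i <;>
    simp [cross, cross_apply, PiLp.inner_apply, Fin.sum_univ_three, -inner_self_eq_norm_sq_to_K] <;> ring

/-- `curl (h • id)(x) = ∇h(x) × x` wherever the scalar `h` is differentiable. [folklore] -/
theorem curl_smul_id_eq_cross_gradient {h : EuclideanSpace ℝ (Fin 3) → ℝ} {x : EuclideanSpace ℝ (Fin 3)}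
    (hh : DifferentiableAt ℝ h x) :
    curl (fun z : EuclideanSpace ℝ (Fin 3) => h z • z) x = cross (gradient h x) x := by
  rw [show (fun z : EuclideanSpace ℝ (Fin 3) => h z • z) = fun z => h z • id z from rfl,
    curl_smul hh differentiableAt_id]
  have h0 : curl (id : EuclideanSpace ℝ (Fin 3) → EuclideanSpace ℝ (Fin 3)) x = 0 := by
    rw [curl_eq_curlCLM, fderiv_id]
    ext i; fin_cases i <;> simp [curlCLM_apply]
  rw [h0, smul_zero, zero_add, id, fderiv_eq_innerSL_gradient, curlCLM_smulRight_innerSL]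

/-- `curl (β • ∇Q)(x) = ∇β(x) × ∇Q(x)` for `β` differentiable at `x` and `Q ∈ C²` (`curl ∇Q = 0`). [folklore] -/
theorem curl_smul_gradient_eq_cross {β Q : EuclideanSpace ℝ (Fin 3) → ℝ} {x : EuclideanSpace ℝ (Fin 3)}
    (hβ : DifferentiableAt ℝ β x) (hQ : ContDiff ℝ 2 Q) :
    curl (fun z : EuclideanSpace ℝ (Fin 3) => β z • gradient Q z) x = cross (gradient β x) (gradient Q x) := by
  have hgQ : DifferentiableAt ℝ (gradient Q) x := (differentiable_gradient_of_contDiff_two hQ) x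
  rw [curl_smul hβ hgQ, curl_gradient_eq_zero_holds Q hQ x, smul_zero, zero_add, fderiv_eq_innerSL_gradient,
    curlCLM_smulRight_innerSL]

/-- ★ **CURL OF THE SINGLE-DEGREE LAMB VECTOR.**  Let `V z = (a ‖z‖ * P z) • z + k ‖z‖ • ∇P z` and `ω z = G ‖z‖ • (∇P z × z)` with
`P ∈ C²` and the radial profiles `a, k, G` differentiable at `‖x‖`, `x ≠ 0`.  Then
`curl (V × ω)(x) = ∇β(x) × ∇P(x) − ∇h(x) × x`, where `β z = G ‖z‖ * (a ‖z‖ * P z * ⟪z,z⟫ + k ‖z‖ * ⟪∇P z, z⟫)` and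
`h z = G ‖z‖ * (a ‖z‖ * P z * ⟪∇P z, z⟫ + k ‖z‖ * ⟪∇P z, ∇P z⟫)`. [folklore] -/
theorem curl_lamb_eq {a k G : ℝ → ℝ} {P : EuclideanSpace ℝ (Fin 3) → ℝ} (hP : ContDiff ℝ 2 P)
    {x : EuclideanSpace ℝ (Fin 3)} (hx : x ≠ 0) (ha : DifferentiableAt ℝ a ‖x‖) (hk : DifferentiableAt ℝ k ‖x‖)
    (hG : DifferentiableAt ℝ G ‖x‖) :
    curl (fun z : EuclideanSpace ℝ (Fin 3) =>
        cross ((a ‖z‖ * P z) • z + k ‖z‖ • gradient P z) (G ‖z‖ • cross (gradient P z) z)) x =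
      cross (gradient (fun z : EuclideanSpace ℝ (Fin 3) =>
          G ‖z‖ * (a ‖z‖ * P z * ⟪z, z⟫ + k ‖z‖ * ⟪gradient P z, z⟫)) x) (gradient P x) -
        cross (gradient (fun z : EuclideanSpace ℝ (Fin 3) =>
          G ‖z‖ * (a ‖z‖ * P z * ⟪gradient P z, z⟫ + k ‖z‖ * ⟪gradient P z, gradient P z⟫)) x) x := by
  -- pointwise BAC–CAB
  have hfun : (fun z : EuclideanSpace ℝ (Fin 3) =>
      cross ((a ‖z‖ * P z) • z + k ‖z‖ • gradient P z) (G ‖z‖ • cross (gradient P z) z)) =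
      fun z => (G ‖z‖ * (a ‖z‖ * P z * ⟪z, z⟫ + k ‖z‖ * ⟪gradient P z, z⟫)) • gradient P z -
        (G ‖z‖ * (a ‖z‖ * P z * ⟪gradient P z, z⟫ + k ‖z‖ * ⟪gradient P z, gradient P z⟫)) • z := by
    funext z
    exact cross_singleDegree_lamb (a ‖z‖) (k ‖z‖) (G ‖z‖) (P z) (gradient P z) z
  rw [hfun]
  -- differentiability of the two scalar coefficients at `x`
  have hn : DifferentiableAt ℝ (fun z : EuclideanSpace ℝ (Fin 3) => ‖z‖) x := (contDiffAt_norm ℝ hx (n := 1)).differentiableAt (by simp)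
  have ha' : DifferentiableAt ℝ (fun z : EuclideanSpace ℝ (Fin 3) => a ‖z‖) x := ha.comp x hn
  have hk' : DifferentiableAt ℝ (fun z : EuclideanSpace ℝ (Fin 3) => k ‖z‖) x := hk.comp x hn
  have hG' : DifferentiableAt ℝ (fun z : EuclideanSpace ℝ (Fin 3) => G ‖z‖) x := hG.comp x hn
  have hPd : DifferentiableAt ℝ P x := (hP.differentiable (by norm_num)) x
  have hgP : DifferentiableAt ℝ (gradient P) x := (differentiable_gradient_of_contDiff_two hP) x
  have hβ : DifferentiableAt ℝ (fun z : EuclideanSpace ℝ (Fin 3) =>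
      G ‖z‖ * (a ‖z‖ * P z * ⟪z, z⟫ + k ‖z‖ * ⟪gradient P z, z⟫)) x :=
    hG'.mul (((ha'.mul hPd).mul (differentiableAt_id.inner ℝ differentiableAt_id)).add
      (hk'.mul (hgP.inner ℝ differentiableAt_id)))
  have hh : DifferentiableAt ℝ (fun z : EuclideanSpace ℝ (Fin 3) =>
      G ‖z‖ * (a ‖z‖ * P z * ⟪gradient P z, z⟫ + k ‖z‖ * ⟪gradient P z, gradient P z⟫)) x :=
    hG'.mul (((ha'.mul hPd).mul (hgP.inner ℝ differentiableAt_id)).add (hk'.mul (hgP.inner ℝ hgP)))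
  have hf1 : DifferentiableAt ℝ (fun z : EuclideanSpace ℝ (Fin 3) =>
      (G ‖z‖ * (a ‖z‖ * P z * ⟪z, z⟫ + k ‖z‖ * ⟪gradient P z, z⟫)) • gradient P z) x := hβ.smul hgP
  have hf2 : DifferentiableAt ℝ (fun z : EuclideanSpace ℝ (Fin 3) =>
      (G ‖z‖ * (a ‖z‖ * P z * ⟪gradient P z, z⟫ + k ‖z‖ * ⟪gradient P z, gradient P z⟫)) • z) x :=
    hh.smul differentiableAt_id
  rw [curl_sub hf1 hf2, curl_smul_gradient_eq_cross hβ hP, curl_smul_id_eq_cross_gradient hh]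

end Summit.NavierStokesRegularity.NavierStokesRegularity.Theorems.PoloidalLiouville.Antidynamo

end
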